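import Summits.BirchSwinnertonDyer.Rank1Residual.AdditivePotMult.QuadraticBaseChangeTamagawaTypeIVUnramified
import HarnessLib

/-!
# Type-`IV` / `IV*` Tamagawa numbers under a RAMIFIED quadratic extension of discrete valuation
# rings (`e = 2`): a `IV` normal form becomes a `IV*` normal form, a `IV*` normal form `π`-descends to
# a `IV` normal form, and in both cases `c = 3` upstairs iff the ORIGINAL Step-5/8 quadratic has a
# root upstairs (row T-MIL-B, file B-2d; seat n1011-p08 GEN 3)

HONEST FRAMING (cell `b2b-bsdres`, run/shared/lean/b2b/bsd-rank1-residual/, verbatim in every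
file): the goal of the cell is to DELETE the COMBINATION-SHAPED residual classes of the
Birch–Swinnerton-Dyer formula for ALL analytic-rank `≤ 1` elliptic curves over `ℚ` — "full BSD
formula for every rank `≤ 1` curve in class `C`" assembled STRICTLY from published theorems — so
that the rank-`≤ 1` remainder becomes exactly the CONSTRUCTION-SHAPED classes, which are TYPED
(missing-input `Prop`s), NOT attempted. This is not "finishing BSD". Sub-classes X3♯(M) / X4(M)
(additive, base-change-and-descend): a RESEARCH ROUTE; they stay CONSTRUCTION-SHAPED; nothing is
booked by this file; no mark / label moved; no consumer binder (`hWR`, `hodd`, A65/A73) changes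
before T-MIL-ODD stage C. THEOREMS ONLY: no definition, no named fact, no `sorry`. OUT OF THIS
ROW (said in every file): the wild sub-case `ℓ = 3 = p ∣ d_K` (this file is meant for the ramified
primes `ℓ ≥ 5` of `K = ℚ(√d_K)`; at `ℓ = 3` the twist side and the `δ`-terms are NOT claimed) and
`ℓ = 2`.

## Setting and what (skeleton `cells/n1011/skel/T-MIL-B.md` §1 (B2)(iii); referee-1 proviso (i))

Abstract extension `R₀ → R` of DVRs with fraction fields `F → L` (as in B-2c), RAMIFIED with
index `2`: `φ ϖ₀ = π² · c` for an irreducible `π ∈ R` and a unit `c`.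
* `normalForm_IVstar_map_of_ramified` — a type-`IV` normal form over `R₀` (`γ, ε`) maps to a
  type-`IV*` normal form over `R` w.r.t. `π` with `γ' = c·φγ`, `ε' = c²·φε`; the residual
  quadratic is rescaled by the unit `c̄` (root-equivalent: `exists_root_rescale_iff`);
* `localTamagawaNumber_baseChange_eq_three_iff_of_normalForm_IV_of_ramified` — (`R` Henselian,
  minimality of the mapped model an explicit binder) **`c((W ⊗ L)/L) = 3 ↔` the ORIGINAL Step-5
  quadratic has a root in `k`**; with `k₀ → k` onto (totally ramified: `f = 1`) and `R₀` Henselian: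
  **`c((W ⊗ L)/L) = 3 ↔ c(W/F) = 3`** — the RAMIFIED base-change entry of (L_ℓ)@3 (`c_w = c_v`);
* `smul_baseChange_eq_descent` / `normalForm_IV_descent_of_ramified` — a type-`IV*` normal form over
  `R₀` (`a₁ = ϖ₀α`, `a₂ = ϖ₀²β`, `a₃ = ϖ₀²γ`, `a₄ = ϖ₀³δ`, `a₆ = ϖ₀⁴ε`) `π`-DESCENDS: the scaling
  `u = π` of `J.map φ` is the `R`-model `(πcα, π²c²β, πc²γ, π²c³δ, π²c⁴ε)`, a type-`IV` normal form
  w.r.t. `π` (`γ″ = c²γ`, `ε″ = c⁴ε`), with `Δ″ · π¹² = φ Δ(J)` (`ord_w Δ_min = 2·ord_v Δ − 12`: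
  the `K`-side `δ`-term is `1`); and the corresponding `c`-statements.

References: Silverman *ATAEC* IV.9.4 Steps 5, 8; *AEC* VII.1 Prop. 1.3. The number-field
instantiation (`𝒪_v → 𝒪_w`, `e = 2`, `f = 1`) is stage C's.
-/

noncomputable section

open scoped Classical

open WeierstrassCurve IsLocalRing Polynomial
  Literature.NumberTheory.EllipticCurves Literature.NumberTheory.EllipticCurves.LocalIndex
  Literature.NumberTheory.DiophantineGeometry.TateAlgorithm

namespace Summit.BirchSwinnertonDyer.Rank1Residual.AdditivePotMult

namespace TypeIVTwist

/-! ### Rescaling a root by a unit of the residue field -/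

/-- `Y² + (cγ̄)Y − c²ε̄` has a root iff `Y² + γ̄Y − ε̄` has one (`c ≠ 0`; `r' = c·r`). [folklore] -/
theorem exists_root_rescale_iff {k : Type*} [Field k] {c : k} (hc : c ≠ 0) (a e : k) :
    (∃ r : k, r ^ 2 + c * a * r - c ^ 2 * e = 0) ↔ ∃ r : k, r ^ 2 + a * r - e = 0 := by
  constructor
  · rintro ⟨r, hr⟩
    refine ⟨r / c, ?_⟩
    field_simp
    linear_combination hr
  · rintro ⟨r, hr⟩
    exact ⟨c * r, by linear_combination c ^ 2 * hr⟩

/-! ### `IV` over `R₀` becomes `IV*` over `R` -/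

section LocalHom

variable {R₀ : Type*} [CommRing R₀] [IsDomain R₀] [IsDiscreteValuationRing R₀]
  (R : Type*) [CommRing R] [IsLocalRing R] [Algebra R₀ R] [IsLocalHom (algebraMap R₀ R)]

/-- **Ramified transport `IV ↦ IV*`.** If `φ ϖ₀ = π²·c` (`c` a unit) and `J` is a type-`IV` normal
form over `R₀` (`a₁, a₂ ∈ 𝔪₀`, `a₃ = ϖ₀γ`, `a₄ ∈ 𝔪₀²`, `a₆ = ϖ₀²ε`), then `J.map φ` is a type-`IV*`
normal form over `R` w.r.t. `π`: `a₁' ∈ 𝔪`, `a₂' ∈ 𝔪²`, `a₃' = π²(c·φγ)`, `a₄' ∈ 𝔪³`,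
`a₆' = π⁴(c²·φε)`. [folklore] -/
theorem normalForm_IVstar_map_of_ramified (J : WeierstrassCurve R₀) (h1 : J.a₁ ∈ maximalIdeal R₀)
    (h2 : J.a₂ ∈ maximalIdeal R₀) {ϖ₀ γ ε : R₀} (hϖ₀ : Irreducible ϖ₀) (hγ : J.a₃ = ϖ₀ * γ)
    (h4 : J.a₄ ∈ maximalIdeal R₀ ^ 2) (hε : J.a₆ = ϖ₀ ^ 2 * ε) {π : R} (hπ : π ∈ maximalIdeal R)
    (c : Rˣ) (hram : algebraMap R₀ R ϖ₀ = π ^ 2 * c) :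
    (J.map (algebraMap R₀ R)).a₁ ∈ maximalIdeal R ∧
      (J.map (algebraMap R₀ R)).a₂ ∈ maximalIdeal R ^ 2 ∧
      (J.map (algebraMap R₀ R)).a₃ = π ^ 2 * ((c : R) * algebraMap R₀ R γ) ∧
      (J.map (algebraMap R₀ R)).a₄ ∈ maximalIdeal R ^ 3 ∧
      (J.map (algebraMap R₀ R)).a₆ = π ^ 4 * ((c : R) ^ 2 * algebraMap R₀ R ε) := by
  have hπ2 : π ^ 2 ∈ maximalIdeal R ^ 2 := Ideal.pow_mem_pow hπ 2
  refine ⟨map_nonunit _ _ h1, ?_, ?_, ?_, ?_⟩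
  · obtain ⟨b, hb⟩ := (mem_maximalIdeal_iff_dvd_of_irreducible hϖ₀ _).mp h2
    rw [WeierstrassCurve.map_a₂, hb, map_mul, hram, mul_assoc]
    exact Ideal.mul_mem_right _ _ hπ2
  · rw [WeierstrassCurve.map_a₃, hγ, map_mul, hram]; ring
  · have h4' : ϖ₀ ^ 2 ∣ J.a₄ := by
      rw [hϖ₀.maximalIdeal_eq, Ideal.span_singleton_pow, Ideal.mem_span_singleton] at h4; exact h4
    obtain ⟨δ, hδ⟩ := h4'
    rw [WeierstrassCurve.map_a₄, hδ, map_mul, map_pow, hram]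
    have e : (π ^ 2 * (c : R)) ^ 2 * algebraMap R₀ R δ = π ^ 4 * ((c : R) ^ 2 * algebraMap R₀ R δ) := by
      ring
    rw [e]
    exact Ideal.mul_mem_right _ _ (Ideal.pow_le_pow_right (by norm_num) (Ideal.pow_mem_pow hπ 4))
  · rw [WeierstrassCurve.map_a₆, hε, map_mul, map_pow, hram]; ring

/-- The residual quadratic after the ramified transport is the original one rescaled by `c̄`:
its discriminant is `c̄²·(γ̄² + 4ε̄)` (nonzero iff the original is). [folklore] -/
theorem residue_disc_ramified_ne_zero_iff (c : Rˣ) (γ ε : R₀) :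
    residue R ((c : R) * algebraMap R₀ R γ) ^ 2 + 4 * residue R ((c : R) ^ 2 * algebraMap R₀ R ε) ≠ 0 ↔
      residue R₀ γ ^ 2 + 4 * residue R₀ ε ≠ 0 := by
  rw [← residue_disc_map_ne_zero_iff R γ ε]
  have e : residue R ((c : R) * algebraMap R₀ R γ) ^ 2 + 4 * residue R ((c : R) ^ 2 * algebraMap R₀ R ε)
      = residue R (c : R) ^ 2 *
        (residue R (algebraMap R₀ R γ) ^ 2 + 4 * residue R (algebraMap R₀ R ε)) := by
    simp only [map_mul, map_pow]; ring
  rw [e, mul_ne_zero_iff]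
  exact ⟨fun h => h.2, fun h => ⟨pow_ne_zero 2 ((residue_ne_zero_iff_isUnit _).mpr c.isUnit), h⟩⟩

/-- The descended model `J″` is a type-`IV` normal form w.r.t. `π` (`π ∈ 𝔪`): `a₁″, a₂″ ∈ 𝔪`,
`a₃″ = π·(c²φγ)`, `a₄″ ∈ 𝔪²`, `a₆″ = π²·(c⁴φε)`. [folklore] -/
theorem normalForm_IV_descent {π : R} (hπ : π ∈ maximalIdeal R) (c : Rˣ) (α' β' γ' δ' ε' : R) :
    let J'' : WeierstrassCurve R :=
      ⟨π * c * α', π ^ 2 * c ^ 2 * β', π * c ^ 2 * γ', π ^ 2 * c ^ 3 * δ', π ^ 2 * c ^ 4 * ε'⟩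
    J''.a₁ ∈ maximalIdeal R ∧ J''.a₂ ∈ maximalIdeal R ∧ J''.a₃ = π * ((c : R) ^ 2 * γ') ∧
      J''.a₄ ∈ maximalIdeal R ^ 2 ∧ J''.a₆ = π ^ 2 * ((c : R) ^ 4 * ε') := by
  refine ⟨?_, ?_, by simp only; ring, ?_, by simp only; ring⟩
  · change π * c * α' ∈ maximalIdeal R
    rw [mul_assoc]; exact Ideal.mul_mem_right _ _ hπ
  · change π ^ 2 * c ^ 2 * β' ∈ maximalIdeal R
    rw [mul_assoc]; exact Ideal.mul_mem_right _ _ (Ideal.pow_le_self two_ne_zero (Ideal.pow_mem_pow hπ 2))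
  · change π ^ 2 * c ^ 3 * δ' ∈ maximalIdeal R ^ 2
    rw [mul_assoc]; exact Ideal.mul_mem_right _ _ (Ideal.pow_mem_pow hπ 2)


end LocalHom

/-! ### `c` upstairs after the ramified transport -/

section Extension

variable {R₀ : Type*} [CommRing R₀] [IsDomain R₀] [IsDiscreteValuationRing R₀]
  {F : Type*} [Field F] [Algebra R₀ F] [IsFractionRing R₀ F]
  {R : Type*} [CommRing R] [IsDomain R] [IsDiscreteValuationRing R]
  {L : Type*} [Field L] [Algebra R L] [IsFractionRing R L]
  [Algebra R₀ R] [Algebra F L] [Algebra R₀ L] [IsScalarTower R₀ R L] [IsScalarTower R₀ F L]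
  [IsLocalHom (algebraMap R₀ R)]

omit [IsFractionRing R₀ F] in
/-- **Type `IV` after a RAMIFIED quadratic extension (`φ ϖ₀ = π²c`, `R` Henselian; minimality of
`(J.map φ) ⊗ L` over `R` an explicit binder): `c((W ⊗ L)/L) = 3 ↔` the ORIGINAL Step-5 quadratic
`Y² + γ̄Y − ε̄` has a root in the residue field of `R`.** (The mapped model is a `IV*` normal form
whose Step-8 quadratic is the original one rescaled by `c̄`.)
[cite: SilvermanATAEC1994, IV.9.4 Steps 5 and 8 (PDF pp. 344, 346)] [cite: SilvermanAEC2009, VII.1 Prop. 1.3(b)] -/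
theorem localTamagawaNumber_baseChange_eq_three_iff_of_normalForm_IV_of_ramified
    [HenselianLocalRing R] (W : WeierstrassCurve F) [W.IsElliptic] (J : WeierstrassCurve R₀)
    (D : VariableChange F) (hJ : D • W = J.baseChange F)
    [((J.map (algebraMap R₀ R)).baseChange L).IsMinimal R]
    (h1 : J.a₁ ∈ maximalIdeal R₀) (h2 : J.a₂ ∈ maximalIdeal R₀) {ϖ₀ γ ε : R₀} (hϖ₀ : Irreducible ϖ₀)
    (hγ : J.a₃ = ϖ₀ * γ) (h4 : J.a₄ ∈ maximalIdeal R₀ ^ 2) (hε : J.a₆ = ϖ₀ ^ 2 * ε)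
    (hdisc : residue R₀ γ ^ 2 + 4 * residue R₀ ε ≠ 0) {π : R} (hπ : Irreducible π) (c : Rˣ)
    (hram : algebraMap R₀ R ϖ₀ = π ^ 2 * c) :
    (W.baseChange L).localTamagawaNumber R = 3 ↔
      ∃ r : ResidueField R, r ^ 2 + residue R (algebraMap R₀ R γ) * r -
        residue R (algebraMap R₀ R ε) = 0 := by
  haveI : (W.baseChange L).IsElliptic := by rw [WeierstrassCurve.baseChange]; infer_instance
  have hπm : π ∈ maximalIdeal R := (IsLocalRing.mem_maximalIdeal _).mpr hπ.not_isUnit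
  obtain ⟨h1', h2', hγ', h4', hε'⟩ :=
    normalForm_IVstar_map_of_ramified R J h1 h2 hϖ₀ hγ h4 hε hπm c hram
  rw [localTamagawaNumber_eq_three_iff_exists_root_of_normalForm_IVstar (W.baseChange L)
      (J.map (algebraMap R₀ R)) (D.map (algebraMap F L)) (smul_baseChange_eq_map_baseChange W J D hJ)
      h1' h2' hπ hγ' h4' hε' ((residue_disc_ramified_ne_zero_iff R c γ ε).mpr hdisc)]
  simp only [map_mul, map_pow]
  exact exists_root_rescale_iff ((residue_ne_zero_iff_isUnit _).mpr c.isUnit) _ _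

/-- **`c_w = c_v` at type `IV` in a TOTALLY RAMIFIED quadratic extension** (`φ ϖ₀ = π²c`, the
residue map `k₀ → k` onto, BOTH rings Henselian): `c((W ⊗ L)/L) = 3 ↔ c(W/F) = 3` — the RAMIFIED
base-change entry of (L_ℓ)@3 (T-MIL-ODD skeleton §1: `[c=3] = [c=3] + 0` together with the
twist side). [cite: SilvermanATAEC1994, IV.9.4 Steps 5 and 8 (PDF pp. 344, 346)] [cite: SilvermanAEC2009, VII.1 Prop. 1.3(b)] -/
theorem localTamagawaNumber_baseChange_eq_three_iff_of_normalForm_IV_of_totallyRamified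
    [HenselianLocalRing R₀] [HenselianLocalRing R] (W : WeierstrassCurve F) [W.IsElliptic]
    (J : WeierstrassCurve R₀) (D : VariableChange F) (hJ : D • W = J.baseChange F)
    [(J.baseChange F).IsMinimal R₀] [((J.map (algebraMap R₀ R)).baseChange L).IsMinimal R]
    (h1 : J.a₁ ∈ maximalIdeal R₀) (h2 : J.a₂ ∈ maximalIdeal R₀) {ϖ₀ γ ε : R₀} (hϖ₀ : Irreducible ϖ₀)
    (hγ : J.a₃ = ϖ₀ * γ) (h4 : J.a₄ ∈ maximalIdeal R₀ ^ 2) (hε : J.a₆ = ϖ₀ ^ 2 * ε)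
    (hdisc : residue R₀ γ ^ 2 + 4 * residue R₀ ε ≠ 0) {π : R} (hπ : Irreducible π) (c : Rˣ)
    (hram : algebraMap R₀ R ϖ₀ = π ^ 2 * c)
    (hres : Function.Surjective (algebraMap (ResidueField R₀) (ResidueField R))) :
    (W.baseChange L).localTamagawaNumber R = 3 ↔ W.localTamagawaNumber R₀ = 3 := by
  rw [localTamagawaNumber_baseChange_eq_three_iff_of_normalForm_IV_of_ramified W J D hJ h1 h2 hϖ₀ hγ
      h4 hε hdisc hπ c hram,
    localTamagawaNumber_eq_three_iff_exists_root_of_normalForm_IV W J D hJ h1 h2 hϖ₀ hγ h4 hε hdisc]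
  have hinj := (algebraMap (ResidueField R₀) (ResidueField R)).injective
  constructor
  · rintro ⟨r, hr⟩
    obtain ⟨r₀, rfl⟩ := hres r
    refine ⟨r₀, hinj ?_⟩
    rw [map_zero]
    simpa only [map_sub, map_add, map_pow, map_mul, ResidueField.algebraMap_residue] using hr
  · rintro ⟨r₀, hr⟩
    refine ⟨algebraMap _ _ r₀, ?_⟩
    have := congrArg (algebraMap (ResidueField R₀) (ResidueField R)) hr
    simpa only [map_sub, map_add, map_pow, map_mul, map_zero, ResidueField.algebraMap_residue] using this

/-! ### `IV*` over `R₀` `π`-descends to `IV` over `R` -/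

omit [IsDomain R₀] [IsDiscreteValuationRing R₀] [IsFractionRing R₀ F] [IsFractionRing R L]
  [IsLocalHom (algebraMap R₀ R)] [IsDomain R] [IsDiscreteValuationRing R] in
/-- **The `π`-descent of a ramified `IV*` normal form, as an explicit `R`-model.** With
`a₁ = ϖ₀α`, `a₂ = ϖ₀²β`, `a₃ = ϖ₀²γ`, `a₄ = ϖ₀³δ`, `a₆ = ϖ₀⁴ε` over `R₀` and `φ ϖ₀ = π²c`, the scaling
`u = π` of `(J.map φ) ⊗ L` is the base change of `J″ = (πcα, π²c²β, πc²γ, π²c³δ, π²c⁴ε)`.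
[folklore] -/
theorem smul_baseChange_eq_descent (J : WeierstrassCurve R₀) {ϖ₀ α β γ δ ε : R₀}
    (hα : J.a₁ = ϖ₀ * α) (hβ : J.a₂ = ϖ₀ ^ 2 * β) (hγ : J.a₃ = ϖ₀ ^ 2 * γ) (hδ : J.a₄ = ϖ₀ ^ 3 * δ)
    (hε : J.a₆ = ϖ₀ ^ 4 * ε) {π : R} (hπ0 : algebraMap R L π ≠ 0) (c : Rˣ)
    (hram : algebraMap R₀ R ϖ₀ = π ^ 2 * c) :
    (⟨Units.mk0 (algebraMap R L π) hπ0, 0, 0, 0⟩ : VariableChange L) •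
        (J.map (algebraMap R₀ R)).baseChange L =
      (⟨π * c * algebraMap R₀ R α, π ^ 2 * c ^ 2 * algebraMap R₀ R β, π * c ^ 2 * algebraMap R₀ R γ,
          π ^ 2 * c ^ 3 * algebraMap R₀ R δ, π ^ 2 * c ^ 4 * algebraMap R₀ R ε⟩ :
        WeierstrassCurve R).baseChange L := by
  have hφ : ∀ x : R₀, algebraMap R L (algebraMap R₀ R x) = algebraMap R₀ L x := fun x =>
    (IsScalarTower.algebraMap_apply R₀ R L x).symm
  have hϖL : algebraMap R₀ L ϖ₀ = algebraMap R L π ^ 2 * algebraMap R L (c : R) := by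
    rw [← hφ, hram, map_mul, map_pow]
  ext
  · simp only [variableChange_a₁, WeierstrassCurve.baseChange, WeierstrassCurve.map_a₁, hα, map_mul,
      Units.val_inv_eq_inv_val, Units.val_mk0, hϖL, hφ]
    field_simp
    ring
  · simp only [variableChange_a₂, WeierstrassCurve.baseChange, WeierstrassCurve.map_a₂,
      WeierstrassCurve.map_a₁, hβ, map_mul, map_pow, Units.val_inv_eq_inv_val, Units.val_mk0, hϖL, hφ,
      mul_zero, zero_mul, sub_zero, add_zero]
    field_simp
    ring
  · simp only [variableChange_a₃, WeierstrassCurve.baseChange, WeierstrassCurve.map_a₃,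
      WeierstrassCurve.map_a₁, hγ, map_mul, map_pow, Units.val_inv_eq_inv_val, Units.val_mk0, hϖL, hφ,
      mul_zero, add_zero]
    field_simp
    ring
  · simp only [variableChange_a₄, WeierstrassCurve.baseChange, WeierstrassCurve.map_a₄,
      WeierstrassCurve.map_a₁, WeierstrassCurve.map_a₂, WeierstrassCurve.map_a₃, hδ, map_mul, map_pow,
      Units.val_inv_eq_inv_val, Units.val_mk0, hϖL, hφ, mul_zero, zero_mul, sub_zero, add_zero]
    field_simp
    ring
  · simp only [variableChange_a₆, WeierstrassCurve.baseChange, WeierstrassCurve.map_a₆,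
      WeierstrassCurve.map_a₁, WeierstrassCurve.map_a₂, WeierstrassCurve.map_a₃, WeierstrassCurve.map_a₄,
      hε, map_mul, map_pow, Units.val_inv_eq_inv_val, Units.val_mk0, hϖL, hφ, mul_zero, zero_mul,
      sub_zero, add_zero]
    field_simp
    ring

omit [IsFractionRing R₀ F] in
/-- **Type `IV*` after a RAMIFIED quadratic extension, via the `π`-descent (`R` Henselian;
minimality of the DESCENDED model `J″ ⊗ L` over `R` an explicit hypothesis): `c((W ⊗ L)/L) = 3 ↔`
the ORIGINAL Step-8 quadratic has a root in the residue field of `R`** (the descended quadratic is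
the original rescaled by `c̄²`). [cite: SilvermanATAEC1994, IV.9.4 Steps 5 and 8 (PDF pp. 344, 346)] [cite: SilvermanAEC2009, VII.1 Prop. 1.3(b)] -/
theorem localTamagawaNumber_baseChange_eq_three_iff_of_normalForm_IVstar_of_ramified
    [HenselianLocalRing R] (W : WeierstrassCurve F) [W.IsElliptic] (J : WeierstrassCurve R₀)
    (D : VariableChange F) (hJ : D • W = J.baseChange F) {ϖ₀ α β γ δ ε : R₀} (hα : J.a₁ = ϖ₀ * α)
    (hβ : J.a₂ = ϖ₀ ^ 2 * β) (hγ : J.a₃ = ϖ₀ ^ 2 * γ) (hδ : J.a₄ = ϖ₀ ^ 3 * δ) (hε : J.a₆ = ϖ₀ ^ 4 * ε)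
    (hdisc : residue R₀ γ ^ 2 + 4 * residue R₀ ε ≠ 0) {π : R} (hπ : Irreducible π) (c : Rˣ)
    (hram : algebraMap R₀ R ϖ₀ = π ^ 2 * c)
    (hmin : ((⟨π * c * algebraMap R₀ R α, π ^ 2 * c ^ 2 * algebraMap R₀ R β,
        π * c ^ 2 * algebraMap R₀ R γ, π ^ 2 * c ^ 3 * algebraMap R₀ R δ,
        π ^ 2 * c ^ 4 * algebraMap R₀ R ε⟩ : WeierstrassCurve R).baseChange L).IsMinimal R) :
    (W.baseChange L).localTamagawaNumber R = 3 ↔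
      ∃ r : ResidueField R, r ^ 2 + residue R (algebraMap R₀ R γ) * r -
        residue R (algebraMap R₀ R ε) = 0 := by
  haveI : (W.baseChange L).IsElliptic := by rw [WeierstrassCurve.baseChange]; infer_instance
  haveI := hmin
  have hπ0 : algebraMap R L π ≠ 0 :=
    (map_ne_zero_iff _ (IsFractionRing.injective R L)).mpr hπ.ne_zero
  have hπm : π ∈ maximalIdeal R := (IsLocalRing.mem_maximalIdeal _).mpr hπ.not_isUnit
  have hdesc := smul_baseChange_eq_descent (L := L) J hα hβ hγ hδ hε hπ0 c hram
  obtain ⟨h1'', h2'', hγ'', h4'', hε''⟩ := normalForm_IV_descent R hπm c (algebraMap R₀ R α)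
    (algebraMap R₀ R β) (algebraMap R₀ R γ) (algebraMap R₀ R δ) (algebraMap R₀ R ε)
  have hJ'' : ((⟨Units.mk0 (algebraMap R L π) hπ0, 0, 0, 0⟩ : VariableChange L) *
      D.map (algebraMap F L)) • W.baseChange L =
      (⟨π * c * algebraMap R₀ R α, π ^ 2 * c ^ 2 * algebraMap R₀ R β,
        π * c ^ 2 * algebraMap R₀ R γ, π ^ 2 * c ^ 3 * algebraMap R₀ R δ,
        π ^ 2 * c ^ 4 * algebraMap R₀ R ε⟩ : WeierstrassCurve R).baseChange L := by
    rw [mul_smul, smul_baseChange_eq_map_baseChange (R := R) W J D hJ, hdesc]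
  have hdisc'' : residue R ((c : R) ^ 2 * algebraMap R₀ R γ) ^ 2 +
      4 * residue R ((c : R) ^ 4 * algebraMap R₀ R ε) ≠ 0 := by
    have e : residue R ((c : R) ^ 2 * algebraMap R₀ R γ) ^ 2 + 4 * residue R ((c : R) ^ 4 * algebraMap R₀ R ε)
        = (residue R (c : R) ^ 2) ^ 2 *
          (residue R (algebraMap R₀ R γ) ^ 2 + 4 * residue R (algebraMap R₀ R ε)) := by
      simp only [map_mul, map_pow]; ring
    rw [e]
    exact mul_ne_zero (pow_ne_zero 2 (pow_ne_zero 2 ((residue_ne_zero_iff_isUnit _).mpr c.isUnit)))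
      ((residue_disc_map_ne_zero_iff R γ ε).mpr hdisc)
  rw [localTamagawaNumber_eq_three_iff_exists_root_of_normalForm_IV (W.baseChange L) _ _ hJ'' h1'' h2''
      hπ hγ'' h4'' hε'' hdisc'']
  simp only [map_mul, map_pow]
  have hc2 : residue R (c : R) ^ 2 ≠ 0 := pow_ne_zero 2 ((residue_ne_zero_iff_isUnit _).mpr c.isUnit)
  have key := exists_root_rescale_iff hc2 (residue R (algebraMap R₀ R γ)) (residue R (algebraMap R₀ R ε))
  have e4 : (residue R (c : R) ^ 2) ^ 2 = residue R (c : R) ^ 4 := by ring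
  rw [e4] at key
  exact key

end Extension

end TypeIVTwist

end Summit.BirchSwinnertonDyer.Rank1Residual.AdditivePotMult

end
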